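import Summits.CriticalPhenomena.PercolationContinuityZ3.Theorems.Transplant.FKConnectivityAllQCountReweightedRigidity
import HarnessLib

/-!
# The four-point inequality ALONE singles out the random-cluster weights: on the 6-cycle the SECOND placement forces log-CONVEXITY,
# so `FourPoint_h` on all finite weighted graphs ⇒ `h` geometric from level `2` on (no hub hypothesis needed)

Support file (`--supports stmt-CriticalPhenomena-4575`), FK sub-lane `prim-bschramm-fk-1` (gen 11) of the post-continuity programme;
builds on p205010 (kernel theorem, internal audit signed; external expert review pending).  Four `def`s (event predicates of the second
placement on the 6-cycle data set `FourPointC6.c6`), no named facts, no sorries; standard axioms (`decide +kernel` for level masses only).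
Nothing here bears on p205010.

`…CountReweightedFourPoint` showed: on the 6-cycle `P0–P1–P2–P3–P4–P5–P0` with placement A = (source `P0`; relays `P1`, `P4` adjacent to
the source; target `P3` antipodal) the four-point inequality under `μ_h ∝ P_½·h(k)` is EQUIVALENT to `h(2)h(4) ≤ h(3)²`.  Here, on the
SAME data set (`c6`: pairs `01, 14, 34, 23, 25, 05`, i.e. the cycle `0–1–4–3–2–5–0`), placement B = (source `0`; relay `a = 1` adjacent to
the source, target `b = 4` adjacent to `a`, relay `c = 2` at distance two on the other side):
* **`fourPoint_c6_dual_iff`** — `FourPointUnder (μ_h) 0 1 2 4 ⟺ h(3)² ≤ h(2)·h(4)`: level masses `x₆ = x₇ ∝ 2h(2)+h(3)`,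
  `x₃ ∝ 4h(2)+4h(3)+h(4)`, `x₄ ∝ h(2)`, so `x₃x₄ − x₆x₇ = (h(2)h(4) − h(3)²)/4096` — the OPPOSITE sign of placement A.
* **`logLinear_at_three_of_fourPoint_fin_six`**, **`logLinear_of_fourPoint_all`** (with the transport `fourPointUnder_image_iff` and
  `logConcave_of_fourPoint_all` of `…CountReweightedRigidity`): if the four-point inequality holds under `μ_h` on every finite weighted
  graph then `h(m)² = h(m−1)·h(m+1)` for EVERY `m ≥ 3`;
* **`geometric_of_fourPoint_all`** — hence `h(k) = h(2)·r^{k−2}` for all `k ≥ 2` (`r = h(3)/h(2)`): among cluster-count reweightings of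
  product measure, Kozma–Nitzan's four-point inequality (the product form of their Theorem 1, the `|A| ≤ 2` engine of additive gluing) can
  hold on all finite graphs ONLY for random-cluster weights (up to the free weight of the one-cluster level) — whereas additive gluing
  itself has no census counterexample for ANY count weight (`AdditiveGluingCountPos`, `MixedLevelGluingPos`).  The converse for geometric
  `h` is the open node `FourPointFKPos`.
[cite: KozmaNitzan2024, Thm. 1, eq. (6) (pp. 7–8)] [cite: Grimmett2006, §1.4 eq. (1.20) (p. 15); §3.9 (pp. 63–65)]
-/

namespace Summit.CriticalPhenomena.PercolationContinuityZ3.Theorems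

namespace FK

open MeasureTheory Set Literature.Probability.LatticeModels Literature.Probability.Percolation
open Literature.Probability.Percolation.DecisionTree (ind ind_of_mem ind_of_not_mem)

namespace FourPointC6

/-! ### Placement B on the 6-cycle: `o = 0`, `a = 1`, `c = 2`, `b = 4` -/

/-- Computable predicate of `{oa|cb} = {0↔1} ∩ {4↔2} ∩ {1↮2}`. [folklore] -/
def q6 (t : Finset (Fin 6)) : Bool := (c6.reachB t 0 1 && c6.reachB t 4 2) && !(c6.reachB t 1 2)
/-- Computable predicate of `{oc|ab} = {0↔2} ∩ {4↔1} ∩ {1↮2}`. [folklore] -/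
def q7 (t : Finset (Fin 6)) : Bool := (c6.reachB t 0 2 && c6.reachB t 4 1) && !(c6.reachB t 1 2)
/-- Computable predicate of `{oab|c} = {0↔1} ∩ {4↔1} ∩ {1↮2}`. [folklore] -/
def q3 (t : Finset (Fin 6)) : Bool := (c6.reachB t 0 1 && c6.reachB t 4 1) && !(c6.reachB t 1 2)
/-- Computable predicate of `{ocb|a} = {0↔2} ∩ {4↔2} ∩ {1↮2}`. [folklore] -/
def q4 (t : Finset (Fin 6)) : Bool := (c6.reachB t 0 2 && c6.reachB t 4 2) && !(c6.reachB t 1 2)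

/-- Level masses of `{oa|cb}` (placement B): `k = 2: 2/64`, `k = 3: 1/64`. [cite: Grimmett2006, §1.4 eq. (1.20) (p. 15)] -/
theorem levB6 : c6.levQ q6 0 = 0 ∧ c6.levQ q6 1 = 0 ∧ c6.levQ q6 2 = 1 / 32 ∧ c6.levQ q6 3 = 1 / 64 ∧ c6.levQ q6 4 = 0 ∧
    c6.levQ q6 5 = 0 ∧ c6.levQ q6 6 = 0 := by decide +kernel
/-- Level masses of `{oc|ab}` (placement B): `k = 2: 2/64`, `k = 3: 1/64`. [cite: Grimmett2006, §1.4 eq. (1.20) (p. 15)] -/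
theorem levB7 : c6.levQ q7 0 = 0 ∧ c6.levQ q7 1 = 0 ∧ c6.levQ q7 2 = 1 / 32 ∧ c6.levQ q7 3 = 1 / 64 ∧ c6.levQ q7 4 = 0 ∧
    c6.levQ q7 5 = 0 ∧ c6.levQ q7 6 = 0 := by decide +kernel
/-- Level masses of `{oab|c}` (placement B): `k = 2: 4/64`, `k = 3: 4/64`, `k = 4: 1/64`. [cite: Grimmett2006, §1.4 eq. (1.20) (p. 15)] -/
theorem levB3 : c6.levQ q3 0 = 0 ∧ c6.levQ q3 1 = 0 ∧ c6.levQ q3 2 = 1 / 16 ∧ c6.levQ q3 3 = 1 / 16 ∧ c6.levQ q3 4 = 1 / 64 ∧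
    c6.levQ q3 5 = 0 ∧ c6.levQ q3 6 = 0 := by decide +kernel
/-- Level masses of `{ocb|a}` (placement B): `k = 2: 1/64`. [cite: Grimmett2006, §1.4 eq. (1.20) (p. 15)] -/
theorem levB4 : c6.levQ q4 0 = 0 ∧ c6.levQ q4 1 = 0 ∧ c6.levQ q4 2 = 1 / 64 ∧ c6.levQ q4 3 = 0 ∧ c6.levQ q4 4 = 0 ∧
    c6.levQ q4 5 = 0 ∧ c6.levQ q4 6 = 0 := by decide +kernel

noncomputable section

open scoped Classical

/-- `conf t ∈ {oa|cb}` (placement B) iff `q6`. [folklore] -/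
theorem memB6 (t : Finset (Fin 6)) :
    c6.conf t ∈ openConn (0 : Fin 6) 1 ∩ openConn (4 : Fin 6) 2 ∩ (sepEv (1 : Fin 6) 2 : Set (BondConfig (Fin 6))) ↔
      q6 t = true := by
  unfold q6
  rw [Set.mem_inter_iff, Set.mem_inter_iff, mem_sepEv_iff, Bool.and_eq_true, Bool.and_eq_true, Bool.not_eq_true',
    ← Bool.not_eq_true, RCEval.reachB_iff, RCEval.reachB_iff, RCEval.reachB_iff]
  rfl

/-- `conf t ∈ {oc|ab}` (placement B) iff `q7`. [folklore] -/
theorem memB7 (t : Finset (Fin 6)) :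
    c6.conf t ∈ openConn (0 : Fin 6) 2 ∩ openConn (4 : Fin 6) 1 ∩ (sepEv (1 : Fin 6) 2 : Set (BondConfig (Fin 6))) ↔
      q7 t = true := by
  unfold q7
  rw [Set.mem_inter_iff, Set.mem_inter_iff, mem_sepEv_iff, Bool.and_eq_true, Bool.and_eq_true, Bool.not_eq_true',
    ← Bool.not_eq_true, RCEval.reachB_iff, RCEval.reachB_iff, RCEval.reachB_iff]
  rfl

/-- `conf t ∈ {oab|c}` (placement B) iff `q3`. [folklore] -/
theorem memB3 (t : Finset (Fin 6)) :
    c6.conf t ∈ openConn (0 : Fin 6) 1 ∩ openConn (4 : Fin 6) 1 ∩ (sepEv (1 : Fin 6) 2 : Set (BondConfig (Fin 6))) ↔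
      q3 t = true := by
  unfold q3
  rw [Set.mem_inter_iff, Set.mem_inter_iff, mem_sepEv_iff, Bool.and_eq_true, Bool.and_eq_true, Bool.not_eq_true',
    ← Bool.not_eq_true, RCEval.reachB_iff, RCEval.reachB_iff, RCEval.reachB_iff]
  rfl

/-- `conf t ∈ {ocb|a}` (placement B) iff `q4`. [folklore] -/
theorem memB4 (t : Finset (Fin 6)) :
    c6.conf t ∈ openConn (0 : Fin 6) 2 ∩ openConn (4 : Fin 6) 2 ∩ (sepEv (1 : Fin 6) 2 : Set (BondConfig (Fin 6))) ↔
      q4 t = true := by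
  unfold q4
  rw [Set.mem_inter_iff, Set.mem_inter_iff, mem_sepEv_iff, Bool.and_eq_true, Bool.and_eq_true, Bool.not_eq_true',
    ← Bool.not_eq_true, RCEval.reachB_iff, RCEval.reachB_iff, RCEval.reachB_iff]
  rfl

/-- `x₆·Z = (2h(2) + h(3))/64` (placement B). [cite: Grimmett2006, §1.4 eq. (1.20) (p. 15)] -/
theorem sumB6 (h : ℕ → ℝ) : ∑ j ∈ Finset.range (c6.n + 1), (c6.levQ q6 j : ℝ) * h j = h 2 / 32 + h 3 / 64 := by
  obtain ⟨e0, e1, e2, e3, e4, e5, e6⟩ := levB6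
  simp only [show c6.n + 1 = 7 from rfl, Finset.sum_range_succ, Finset.sum_range_zero, e0, e1, e2, e3, e4, e5, e6]
  push_cast
  ring

/-- `x₇·Z = (2h(2) + h(3))/64` (placement B). [cite: Grimmett2006, §1.4 eq. (1.20) (p. 15)] -/
theorem sumB7 (h : ℕ → ℝ) : ∑ j ∈ Finset.range (c6.n + 1), (c6.levQ q7 j : ℝ) * h j = h 2 / 32 + h 3 / 64 := by
  obtain ⟨e0, e1, e2, e3, e4, e5, e6⟩ := levB7
  simp only [show c6.n + 1 = 7 from rfl, Finset.sum_range_succ, Finset.sum_range_zero, e0, e1, e2, e3, e4, e5, e6]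
  push_cast
  ring

/-- `x₃·Z = (4h(2) + 4h(3) + h(4))/64` (placement B). [cite: Grimmett2006, §1.4 eq. (1.20) (p. 15)] -/
theorem sumB3 (h : ℕ → ℝ) : ∑ j ∈ Finset.range (c6.n + 1), (c6.levQ q3 j : ℝ) * h j = h 2 / 16 + h 3 / 16 + h 4 / 64 := by
  obtain ⟨e0, e1, e2, e3, e4, e5, e6⟩ := levB3
  simp only [show c6.n + 1 = 7 from rfl, Finset.sum_range_succ, Finset.sum_range_zero, e0, e1, e2, e3, e4, e5, e6]
  push_cast
  ring

/-- `x₄·Z = h(2)/64` (placement B). [cite: Grimmett2006, §1.4 eq. (1.20) (p. 15)] -/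
theorem sumB4 (h : ℕ → ℝ) : ∑ j ∈ Finset.range (c6.n + 1), (c6.levQ q4 j : ℝ) * h j = h 2 / 64 := by
  obtain ⟨e0, e1, e2, e3, e4, e5, e6⟩ := levB4
  simp only [show c6.n + 1 = 7 from rfl, Finset.sum_range_succ, Finset.sum_range_zero, e0, e1, e2, e3, e4, e5, e6]
  push_cast
  ring

end

end FourPointC6

noncomputable section

open scoped Classical
open FourPointC6

/-- **Placement B on the 6-cycle forces log-CONVEXITY**: `FourPointUnder (μ_h) 0 1 2 4 ⟺ h(3)² ≤ h(2)·h(4)` (every positive `h`;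
`x₃x₄ − x₆x₇ = (h(2)h(4) − h(3)²)/(4096·Z²)`, the opposite sign of placement A). [cite: KozmaNitzan2024, Thm. 1, eq. (6) (pp. 7–8)]
[cite: Grimmett2006, §1.4 eq. (1.20) (p. 15); §3.9 (pp. 63–65)] -/
theorem fourPoint_c6_dual_iff {h : ℕ → ℝ} (hpos : ∀ k, 0 < h k) :
    FourPointUnder (crMeasure c6.w h) (0 : Fin 6) 1 2 4 ↔ h 3 ^ 2 ≤ h 2 * h 4 := by
  unfold FourPointUnder
  rw [RCEval.cr_real_eq_levels_div valid hpos memB6, RCEval.cr_real_eq_levels_div valid hpos memB7,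
    RCEval.cr_real_eq_levels_div valid hpos memB3, RCEval.cr_real_eq_levels_div valid hpos memB4, sumB6 h, sumB7 h, sumB3 h, sumB4 h]
  have hZ : 0 < crPartition c6.w h := crPartition_pos c6.w hpos
  rw [div_mul_div_comm, div_mul_div_comm, div_le_div_iff_of_pos_right (mul_pos hZ hZ)]
  have h2 := hpos 2
  have h3 := hpos 3
  have h4 := hpos 4
  constructor
  · intro H
    nlinarith [H]
  · intro H
    nlinarith [H]

/-- **The four-point inequality on all 6-vertex weighted graphs forces `h(3)² = h(2)·h(4)`** (placements A and B on the 6-cycle).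
[cite: KozmaNitzan2024, Thm. 1 (p. 7)] -/
theorem logLinear_at_three_of_fourPoint_fin_six {h : ℕ → ℝ} (hpos : ∀ k, 0 < h k)
    (hfp : ∀ (w : Sym2 (Fin 6) → unitInterval) (o a c b : Fin 6), FourPointUnder (crMeasure w h) o a c b) :
    h 3 ^ 2 = h 2 * h 4 :=
  le_antisymm ((fourPoint_c6_dual_iff hpos).1 (hfp c6.w 0 1 2 4)) (logConcaveAt_three_of_fourPoint_fin_six hpos hfp)

/-- **Log-convexity at every level `m ≥ 3` from the four-point inequality on all graphs** (placement B padded with idle vertices).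
[cite: KozmaNitzan2024, Thm. 1 (p. 7)] [cite: Grimmett2006, Lemma (4.13) (p. 71)] -/
theorem logConvex_of_fourPoint_all {h : ℕ → ℝ} (hpos : ∀ k, 0 < h k)
    (hfp : ∀ (n : ℕ) (w : Sym2 (Fin n) → unitInterval) (o a c b : Fin n), FourPointUnder (crMeasure w h) o a c b)
    {m : ℕ} (hm : 3 ≤ m) : h m ^ 2 ≤ h (m - 1) * h (m + 1) := by
  obtain ⟨i, rfl⟩ : ∃ i, m = 3 + i := ⟨m - 3, by omega⟩
  set j : Fin 6 ↪ Fin (6 + i) := Fin.castAddEmb i with hj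
  set w' : Sym2 (Fin (6 + i)) → unitInterval := Function.extend (Sym2.map j) c6.w 0 with hw'
  have hvan : ∀ e, e ∉ Set.range (Sym2.map j) → w' e = 0 := fun e he => extend_sym2Map_eq_zero j _ he
  have hcomp : (fun e => w' (Sym2.map j e)) = c6.w := funext fun e => extend_sym2Map_apply j _ e
  have key := (fourPointUnder_image_iff j w' hvan hpos 0 1 2 4).1 (hfp (6 + i) w' (j 0) (j 1) (j 2) (j 4))
  rw [hcomp, hj, card_idle_castAddEmb] at key
  have hc := (fourPoint_c6_dual_iff (h := fun k => h (k + i)) (fun k => hpos _)).1 key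
  have e1 : 3 + i - 1 = 2 + i := by omega
  have e2 : 3 + i + 1 = 4 + i := by omega
  rw [e1, e2]
  simpa using hc

/-- **The four-point inequality on all finite weighted graphs forces `h(m)² = h(m−1)h(m+1)` for every `m ≥ 3`** — no hub hypothesis.
[cite: KozmaNitzan2024, Thm. 1 (p. 7)] [cite: Grimmett2006, §3.9 (pp. 63–65)] -/
theorem logLinear_of_fourPoint_all {h : ℕ → ℝ} (hpos : ∀ k, 0 < h k)
    (hfp : ∀ (n : ℕ) (w : Sym2 (Fin n) → unitInterval) (o a c b : Fin n), FourPointUnder (crMeasure w h) o a c b)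
    {m : ℕ} (hm : 3 ≤ m) : h m ^ 2 = h (m - 1) * h (m + 1) :=
  le_antisymm (logConvex_of_fourPoint_all hpos hfp hm) (by have := logConcave_of_fourPoint_all hpos hfp hm; linarith)

/-- **RIGIDITY from the four-point inequality alone**: if Kozma–Nitzan's four-point inequality holds under `μ_h ∝ P_w·h(k)` on every finite
weighted graph, then `h(k) = h(2)·r^{k−2}` for all `k ≥ 2` (`r = h(3)/h(2)`), i.e. `μ_h` is a random-cluster measure up to the free weight
of the one-cluster level. [cite: KozmaNitzan2024, Thm. 1 (p. 7)] [cite: Grimmett2006, §1.4 eq. (1.20) (p. 15); §3.9 (pp. 63–65)] -/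
theorem geometric_of_fourPoint_all {h : ℕ → ℝ} (hpos : ∀ k, 0 < h k)
    (hfp : ∀ (n : ℕ) (w : Sym2 (Fin n) → unitInterval) (o a c b : Fin n), FourPointUnder (crMeasure w h) o a c b)
    (k : ℕ) (hk : 2 ≤ k) : h k = h 2 * (h 3 / h 2) ^ (k - 2) := by
  have ratio : ∀ m, 2 ≤ m → h (m + 1) / h m = h 3 / h 2 := by
    intro m hm
    induction m with
    | zero => omega
    | succ m ih =>
      rcases Nat.lt_or_ge m 2 with hlt | hge
      · interval_cases m
        · omega
        · norm_num
      · have hll := logLinear_of_fourPoint_all hpos hfp (m := m + 1) (by omega)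
        simp only [Nat.add_sub_cancel] at hll
        have hm0 := hpos m
        have hm1 := hpos (m + 1)
        rw [← ih hge]
        field_simp
        nlinarith [hll]
  induction k with
  | zero => omega
  | succ k ih =>
    rcases Nat.lt_or_ge k 2 with hlt | hge
    · interval_cases k
      · omega
      · simp
    · have hr := ratio k hge
      have hk0 := hpos k
      rw [show k + 1 - 2 = (k - 2) + 1 by omega, pow_succ, ← mul_assoc, ← ih hge, ← hr]
      field_simp

end

end FK

end Summit.CriticalPhenomena.PercolationContinuityZ3.Theorems
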